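import Summits.ABC.Analytic.PolySzpiro
import Literature.NumberTheory.EllipticCurves.SzpiroOfAbcProofs
import Literature.NumberTheory.DiophantineGeometry.GenEllThm21With
import Literature.NumberTheory.DiophantineGeometry.AbcWave0QualityFormProofs
import HarnessLib
import HarnessLib.Audit

/-!
# ABC — analytic / modular lens: GLUE for the degree parcel, part 2 — the partial converse weak-abc ⟹ A-PS (proof-only)

Cell `abc-an` (C1), seat `pr-2` (GLUE-DEG; GLUE LEDGER edge E21♭; companion of `Summits/ABC/Analytic/GlueDegree.lean`, split
for the 400-line cap). PROOF-ONLY: no definition, no `sorry`, no named-fact hypothesis.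
HONESTY: abc is not proved by any of this. **A-PS** (`Summit.ABC.PolySzpiroRat`) is **NOT abc — «NOT abc — POLY-SZPIRO(E)»**;
«abc with a fixed exponent `Λ > 1`» is NOT abc either. Typed ≠ proved: every conjecture below is a hypothesis.

## §3 E21♭ — abc with a FIXED exponent `≤ 1 + 1/41` ⟹ rung A-PS (`K = 7`)

Silverman AEC VIII.11.5(b) + Ex. 8.21 (abc ⟹ Szpiro `6+ε`, tree `szpiro_of_abcLe_holds`) run with a FIXED abc exponent `1 + ε`:
the `c₄³ − c₆² = 1728Δ` triple of a global minimal equation gives `|Δ_min| ≪ N^{6(1+ε)/(1−5ε)}`, a bound exactly when `ε < 1/5`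
(abc-exponent `< 6/5`: `rad ≤ |c₄ c₆| · rad(6Δ) ≲ max^{5/6} · 6N` saturates there). The tree's arithmetic core
`SzpiroOfAbc.core_main` / `real_step` is stated for `ε ≤ 1/41`; that is the range certified here (extending `real_step` to
`ε < 1/5` is bookkeeping, not done):
* `natAbs_le_of_abcLe_fixedExponent` — the core with a fixed exponent (degenerate cases `c₄ c₆ = 0` included);
* `polySzpiroRatEff_of_abcLe_fixedExponent` — `(∀ abc-triples, c ≤ K rad^{1+ε}) → PolySzpiroRatEff (6(1+ε)/(1−5ε)) (log C')`,
  `C' = (432 · 6^ε · K)^{6/(1−5ε)} + 2²¹ 3¹⁶` (EFFECTIVE);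
* `polySzpiroRatEff_seven_of_abcLe` (`ε = 1/41` ↦ `K = 7`) and **E21♭** `polySzpiroRat_of_abcWithExponent_lt :
  Λ < 42/41 → GenEll.ABCWithExponent Λ → Summit.ABC.PolySzpiroRat`.
With part 1 (`exists_abcWithExponent_of_polySzpiroRat`: A-PS ⟹ weak-abc with `Λ = K/5 > 6/5`) the kernel placement of A-PS is
a SANDWICH: `ABC = ABCWithExponent 1 ⟹ ABCWithExponent Λ (1 < Λ < 42/41) ⟹ A-PS ⟹ ∃ Λ' > 6/5, ABCWithExponent Λ'`; no
converse weak-abc(`Λ ≥ 6/5`) ⟹ A-PS is in print (presearch: Silverman AEC pp. 223–224, Bombieri–Gubler p. 436–437, Vojta LNM 1239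
App. ABC pp. 63–64 — all through `c₄³ − c₆²`; null otherwise).

References: [SilvermanAEC2009] VIII.11.5(b), Ex. 8.21; [Oesterle1988] §3; [MochizukiGenEll2010] Thm 2.1 (the predicate
`ABCWithExponent`); [PastenShimura2024] Conj. 1.1.
-/

noncomputable section

namespace Summit.ABC.Analytic

open Literature.NumberTheory.EllipticCurves Literature.NumberTheory.DiophantineGeometry WeierstrassCurve
open Summit.ABC

/-! ## §3 E21♭ — the partial CONVERSE: abc with a FIXED exponent `≤ 1 + 1/41` ⟹ rung A-PS (`K = 7`)

Silverman AEC VIII.11.5(b) + Ex. 8.21 (abc ⟹ Szpiro `6+ε`) run with a FIXED abc exponent `1 + ε`: the `c₄³ − c₆² = 1728Δ`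
triple gives `|Δ_min| ≪ N^{6(1+ε)/(1−5ε)}`, which is a bound exactly when `ε < 1/5` (abc-exponent `< 6/5`); the tree's
arithmetic core `SzpiroOfAbc.core_main` / `real_step` is stated for `ε ≤ 1/41`, and that is the range certified here (extending
`real_step` to `ε < 1/5` is bookkeeping, not done). So «weak abc with exponent `Λ < 42/41`» ⟹ A-PS with `K = 7`; for
`Λ ≥ 6/5` NO implication weak-abc(Λ) ⟹ A-PS is known (presearch null), while A-PS ⟹ weak-abc(`K/5`) with `K/5 > 6/5` (§1):
the placement of §1 is a SANDWICH, not an equivalence. -/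

/-- **Arithmetic core with a FIXED abc exponent** (`SzpiroOfAbc.natAbs_le_of_abcLe` with `1 + ε`, `0 < ε ≤ 1/41`, in place of
`∀ ε`): if `c ≤ K · rad(abc)^{1+ε}` for every abc triple, then for all integers `x = c₄`, `y = c₆`, `D = Δ ≠ 0` with
`x³ − y² = 1728 D` and every `N ≥ 1` satisfying the conductor conditions `H1`–`H2` and the minimality constraints `H3`–`H5` of a
global minimal equation, `|D| ≤ ((432 · 6^ε · K)^{6/(1−5ε)} + 2²¹ 3¹⁶) · N^{6(1+ε)/(1−5ε)}` (main case `SzpiroOfAbc.core_main`;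
degenerate cases `c₄ = 0` / `c₆ = 0`: `|Δ| ≤ 2²¹ 3¹⁶ N⁵`, `SzpiroOfAbc.core_m_zero` / `core_n_zero`).
[cite: SilvermanAEC2009, Prop. VIII.11.5(b) and Ex. 8.21] -/
theorem natAbs_le_of_abcLe_fixedExponent {ε K : ℝ} (hε : 0 < ε) (hε' : ε ≤ 1 / 41)
    (hK : ∀ a b c : ℕ, IsABCTriple a b c → (c : ℝ) ≤ K * ((rad a b c : ℕ) : ℝ) ^ (1 + ε))
    (x y D : ℤ) (N : ℕ) (hD : D ≠ 0) (hN : N ≠ 0) (hrel : x ^ 3 - y ^ 2 = 1728 * D)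
    (H1 : ∀ p : ℕ, p.Prime → (p : ℤ) ∣ D → p ∣ N)
    (H2 : ∀ p : ℕ, p.Prime → 5 ≤ p → (p : ℤ) ∣ D → (p : ℤ) ∣ x → p ^ 2 ∣ N)
    (H3 : ∀ p : ℕ, p.Prime → 5 ≤ p → (p : ℤ) ^ 4 ∣ x → ¬ (p : ℤ) ^ 6 ∣ y)
    (H4 : (2 : ℤ) ^ 8 ∣ x → ¬ (2 : ℤ) ^ 11 ∣ y) (H5 : (3 : ℤ) ^ 5 ∣ x → ¬ (3 : ℤ) ^ 9 ∣ y) :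
    (D.natAbs : ℝ) ≤ ((432 * (6 : ℝ) ^ ε * K) ^ (6 / (1 - 5 * ε)) + 2 ^ 21 * 3 ^ 16) *
      (N : ℝ) ^ (6 * (1 + ε) / (1 - 5 * ε)) := by
  have hKpos : 0 < K := SzpiroOfAbc.abc_const_pos hK
  set A : ℝ := (432 * (6 : ℝ) ^ ε * K) ^ (6 / (1 - 5 * ε)) with hA
  have hApos : 0 < A := by positivity
  set e : ℝ := 6 * (1 + ε) / (1 - 5 * ε) with he
  have hθ : 0 < 1 - 5 * ε := by linarith
  have he6 : 6 ≤ e := by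
    rw [he, le_div_iff₀ hθ]; nlinarith
  have hN1 : (1 : ℝ) ≤ N := by exact_mod_cast Nat.one_le_iff_ne_zero.mpr hN
  have hNpow2 : ((N ^ 5 : ℕ) : ℝ) ≤ (N : ℝ) ^ e := by
    have : ((N ^ 5 : ℕ) : ℝ) = (N : ℝ) ^ ((5 : ℕ) : ℝ) := by
      rw [Real.rpow_natCast]; push_cast; ring
    rw [this]
    exact Real.rpow_le_rpow_of_exponent_le hN1 (by norm_num; linarith)
  have hNpow0 : 0 ≤ (N : ℝ) ^ e := by positivity
  -- pass to natural numbers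
  have hrel' := SzpiroOfAbc.natAbs_rel hrel
  set m := x.natAbs with hm
  set n := y.natAbs with hn
  set d := D.natAbs with hd
  have hd0 : d ≠ 0 := Int.natAbs_ne_zero.mpr hD
  have H1' : ∀ p : ℕ, p.Prime → p ∣ d → p ∣ N := fun p hp h ↦ H1 p hp (Int.natCast_dvd.mpr h)
  have H2' : ∀ p : ℕ, p.Prime → 5 ≤ p → p ∣ d → p ∣ m → p ^ 2 ∣ N :=
    fun p hp h5 h h' ↦ H2 p hp h5 (Int.natCast_dvd.mpr h) (Int.natCast_dvd.mpr h')
  have hpow : ∀ (p k : ℕ) (z : ℤ), (p : ℤ) ^ k ∣ z ↔ p ^ k ∣ z.natAbs := fun p k z ↦ by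
    rw [← Int.natCast_dvd]; push_cast; rfl
  have H3' : ∀ p : ℕ, p.Prime → 5 ≤ p → p ^ 4 ∣ m → ¬ p ^ 6 ∣ n := fun p hp h5 h h' ↦
    H3 p hp h5 ((hpow p 4 x).mpr h) ((hpow p 6 y).mpr h')
  have H4' : 2 ^ 8 ∣ m → ¬ 2 ^ 11 ∣ n := fun h h' ↦
    H4 ((hpow 2 8 x).mpr h) ((hpow 2 11 y).mpr h')
  have H5' : 3 ^ 5 ∣ m → ¬ 3 ^ 9 ∣ n := fun h h' ↦
    H5 ((hpow 3 5 x).mpr h) ((hpow 3 9 y).mpr h')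
  -- three cases
  rcases eq_or_ne m 0 with hm0 | hm0
  · -- `c₄ = 0`
    have hrel0 : n ^ 2 = 1728 * d := by
      rw [hm0] at hrel'
      rcases hrel' with h | h | h <;> omega
    have h := SzpiroOfAbc.core_m_zero hd0 hN hrel0 (fun p hp h5 hpd ↦ H2' p hp h5 hpd (hm0 ▸ dvd_zero p))
      (fun p hp h5 ↦ H3' p hp h5 (hm0 ▸ dvd_zero _)) (H4' (hm0 ▸ dvd_zero _))
      (H5' (hm0 ▸ dvd_zero _))
    have h' : (d : ℝ) ≤ 2 ^ 20 * 3 ^ 16 * ((N ^ 5 : ℕ) : ℝ) := by exact_mod_cast h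
    calc (d : ℝ) ≤ 2 ^ 20 * 3 ^ 16 * ((N ^ 5 : ℕ) : ℝ) := h'
      _ ≤ 2 ^ 21 * 3 ^ 16 * (N : ℝ) ^ e := by nlinarith
      _ ≤ (A + 2 ^ 21 * 3 ^ 16) * (N : ℝ) ^ e := by nlinarith
  rcases eq_or_ne n 0 with hn0 | hn0
  · -- `c₆ = 0`
    have hrel0 : m ^ 3 = 1728 * d := by
      rw [hn0] at hrel'
      rcases hrel' with h | h | h <;> omega
    have h := SzpiroOfAbc.core_n_zero hd0 hN hrel0 H2'
      (fun p hp h5 h4 ↦ H3' p hp h5 h4 (hn0 ▸ dvd_zero _)) (fun h ↦ H4' h (hn0 ▸ dvd_zero _))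
      (fun h ↦ H5' h (hn0 ▸ dvd_zero _))
    have h' : (d : ℝ) ≤ 2 ^ 21 * 3 ^ 12 * ((N ^ 5 : ℕ) : ℝ) := by exact_mod_cast h
    calc (d : ℝ) ≤ 2 ^ 21 * 3 ^ 12 * ((N ^ 5 : ℕ) : ℝ) := h'
      _ ≤ 2 ^ 21 * 3 ^ 16 * (N : ℝ) ^ e := by nlinarith
      _ ≤ (A + 2 ^ 21 * 3 ^ 16) * (N : ℝ) ^ e := by nlinarith
  · -- main case
    have h := SzpiroOfAbc.core_main hε hε' hK hm0 hn0 hd0 hN hrel' H1' H2' H3' H4' H5'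
    calc (d : ℝ) ≤ A * (N : ℝ) ^ (6 * (1 + ε) / (1 - 5 * ε)) := h
      _ ≤ (A + 2 ^ 21 * 3 ^ 16) * (N : ℝ) ^ e := by rw [← he]; nlinarith

/-- **E21♭-eff: abc with a FIXED exponent `1 + ε` (`0 < ε ≤ 1/41`, constant `K`) ⟹ A-PS-eff `(6(1+ε)/(1−5ε), log C')`,
`C' = (432 · 6^ε · K)^{6/(1−5ε)} + 2²¹ 3¹⁶`** — Silverman AEC VIII.11.5(b) + Ex. 8.21 with the exponent bookkept (the tree's
`szpiro_of_abcLe_holds` is the case «`∀ ε`»): global minimal equation `W₀/ℤ` (`exists_baseChange_int_forall_isMinimalAt`),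
`|Δ_min| = |Δ(W₀)|`, bad primes divide `N_E`, additive ones twice, minimality constraints, then `natAbs_le_of_abcLe_fixedExponent`
and logarithms. «NOT abc — POLY-SZPIRO(E = 6(1+ε)/(1−5ε))». [cite: SilvermanAEC2009, Prop. VIII.11.5(b) and Ex. 8.21] -/
theorem polySzpiroRatEff_of_abcLe_fixedExponent {ε K : ℝ} (hε : 0 < ε) (hε' : ε ≤ 1 / 41)
    (hK : ∀ a b c : ℕ, IsABCTriple a b c → (c : ℝ) ≤ K * ((rad a b c : ℕ) : ℝ) ^ (1 + ε)) :
    PolySzpiroRatEff (6 * (1 + ε) / (1 - 5 * ε))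
      (Real.log ((432 * (6 : ℝ) ^ ε * K) ^ (6 / (1 - 5 * ε)) + 2 ^ 21 * 3 ^ 16)) := by
  intro W _
  have hKpos : 0 < K := SzpiroOfAbc.abc_const_pos hK
  set A' : ℝ := (432 * (6 : ℝ) ^ ε * K) ^ (6 / (1 - 5 * ε)) + 2 ^ 21 * 3 ^ 16 with hA'
  have hA'pos : 0 < A' := by positivity
  obtain ⟨C, W₀, hCW, hmin⟩ := exists_baseChange_int_forall_isMinimalAt W
  -- `Δ(W₀) ≠ 0`
  have hΔ0 : W₀.Δ ≠ 0 := by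
    intro h0
    have h1 : (C • W).Δ = 0 := by simp [hCW, WeierstrassCurve.baseChange, WeierstrassCurve.map_Δ, h0]
    exact (C • W).isUnit_Δ.ne_zero h1
  -- `N_E` and `|Δ_min|` computed on `W₀`
  have hN : W.conductorNorm ℤ = (W₀.baseChange ℚ).conductorNorm ℤ := by
    rw [← hCW, conductorNorm_smul_rat]
  have hD : W.minimalDiscriminantNorm ℤ = W₀.Δ.natAbs := by
    rw [← minimalDiscriminantNorm_smul_rat W C, hCW,
      minimalDiscriminantNorm_eq_natAbs_holds W₀ hΔ0 hmin]
  haveI := WeierstrassCurve.isElliptic_baseChange_int W₀ hΔ0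
  have hNne : (W₀.baseChange ℚ).conductorNorm ℤ ≠ 0 :=
    (conductorNorm_pos_holds (W₀.baseChange ℚ)).ne'
  have hplace : ∀ (p : ℕ) (hp : p.Prime), ∃ v : IsDedekindDomain.HeightOneSpectrum ℤ,
      Rat.HeightOneSpectrum.natGenerator v = p :=
    fun p hp ↦ ⟨_, WeierstrassCurve.natGenerator_primesEquiv_symm p hp⟩
  have key := natAbs_le_of_abcLe_fixedExponent hε hε' hK W₀.c₄ W₀.c₆ W₀.Δ
    ((W₀.baseChange ℚ).conductorNorm ℤ) hΔ0 hNne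
    (by linear_combination (-1 : ℤ) * W₀.c_relation)
    (fun p hp hpΔ ↦ WeierstrassCurve.dvd_conductorNorm_of_dvd_Δ W₀ hΔ0 hmin hp hpΔ)
    (fun p hp _ hpΔ hpc ↦ WeierstrassCurve.sq_dvd_conductorNorm_of_dvd_Δ_of_dvd_c₄ W₀ hΔ0 hmin hp hpΔ hpc)
    (fun p hp h5 h4 h6 ↦ by
      obtain ⟨v, hv⟩ := hplace p hp
      exact not_pow_dvd_c₄_c₆_of_isMinimalAt v W₀ hΔ0 (hmin v) (hv ▸ h5)
        ⟨hv ▸ h4, hv ▸ h6⟩)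
    (fun h4 h6 ↦ by
      obtain ⟨v, hv⟩ := hplace 2 Nat.prime_two
      exact not_pow_dvd_c₄_c₆_of_isMinimalAt_two v W₀ hΔ0 (hmin v) hv ⟨h4, h6⟩)
    (fun h4 h6 ↦ by
      obtain ⟨v, hv⟩ := hplace 3 Nat.prime_three
      exact not_pow_dvd_c₄_c₆_of_isMinimalAt_three v W₀ hΔ0 (hmin v) hv ⟨h4, h6⟩)
  rw [hD, hN]
  -- logarithms
  have hΔpos : (0 : ℝ) < (W₀.Δ.natAbs : ℝ) := by exact_mod_cast Int.natAbs_pos.mpr hΔ0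
  have hNpos : (0 : ℝ) < ((W₀.baseChange ℚ).conductorNorm ℤ : ℝ) := by
    exact_mod_cast conductorNorm_pos_holds (W₀.baseChange ℚ)
  have h1 := Real.log_le_log hΔpos key
  rw [Real.log_mul hA'pos.ne' (Real.rpow_pos_of_pos hNpos _).ne', Real.log_rpow hNpos] at h1
  linarith

/-- **E21♭: abc with a fixed exponent `≤ 42/41` ⟹ A-PS with `K = 7`** (`ε = 1/41`: `6 · (42/41)/(36/41) = 7`):
`(∀ abc-triples, c ≤ K · rad^{42/41}) → PolySzpiroRatEff 7 (log C')`. «NOT abc — POLY-SZPIRO(7)».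
[cite: SilvermanAEC2009, Prop. VIII.11.5(b) and Ex. 8.21] -/
theorem polySzpiroRatEff_seven_of_abcLe {K : ℝ}
    (hK : ∀ a b c : ℕ, IsABCTriple a b c → (c : ℝ) ≤ K * ((rad a b c : ℕ) : ℝ) ^ (42 / 41 : ℝ)) :
    ∃ C : ℝ, PolySzpiroRatEff 7 C := by
  have h := polySzpiroRatEff_of_abcLe_fixedExponent (ε := 1 / 41) (K := K) (by norm_num) le_rfl
    (fun a b c habc => by have := hK a b c habc; norm_num at this ⊢; exact this)
  norm_num at h
  exact ⟨_, h⟩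

/-- **E21♭ (GLUE LEDGER): the weak abc conjecture with ANY exponent `Λ < 42/41` implies rung A-PS (with `K = 7`)** —
`GenEll.ABCWithExponent Λ → Λ < 42/41 → Summit.ABC.PolySzpiroRat`: pick `ε' > 0` with `Λ(1+ε') ≤ 42/41`, so
`c < C · rad^{Λ(1+ε')} ≤ C · rad^{42/41}` (`rad ≥ 1`), then `polySzpiroRatEff_seven_of_abcLe`. The `c₄³ − c₆²` argument
extends to `Λ < 6/5` (not certified here); for `Λ ≥ 6/5` no converse is known — A-PS gives back only `Λ = K/5 > 6/5` (§1).
«NOT abc — POLY-SZPIRO(7)»; «abc with exponent `Λ < 42/41`» is NOT abc either (abc = `Λ = 1`). [cite: SilvermanAEC2009, Prop. VIII.11.5(b)] -/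
theorem polySzpiroRat_of_abcWithExponent_lt {Λ : ℝ} (hΛ : Λ < 42 / 41) (h : GenEll.ABCWithExponent Λ) :
    PolySzpiroRat := by
  -- an `ε' > 0` with `Λ (1 + ε') ≤ 42/41`
  obtain ⟨ε', hε', hΛε⟩ : ∃ ε' : ℝ, 0 < ε' ∧ Λ * (1 + ε') ≤ 42 / 41 := by
    by_cases hΛ0 : Λ ≤ 0
    · exact ⟨1, one_pos, by nlinarith⟩
    · push Not at hΛ0
      refine ⟨(42 / 41) / Λ - 1, by rw [sub_pos, lt_div_iff₀ hΛ0]; linarith, ?_⟩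
      rw [show Λ * (1 + ((42 / 41) / Λ - 1)) = 42 / 41 by field_simp; ring]
  obtain ⟨C, hC, hCΛ⟩ := h ε' hε'
  have hK : ∀ a b c : ℕ, IsABCTriple a b c → (c : ℝ) ≤ C * ((rad a b c : ℕ) : ℝ) ^ (42 / 41 : ℝ) := by
    intro a b c habc
    have hR1 : (1 : ℝ) ≤ ((rad a b c : ℕ) : ℝ) := by exact_mod_cast le_trans one_le_two habc.two_le_rad
    calc (c : ℝ) ≤ C * ((rad a b c : ℕ) : ℝ) ^ (Λ * (1 + ε')) := (hCΛ a b c habc).le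
      _ ≤ C * ((rad a b c : ℕ) : ℝ) ^ (42 / 41 : ℝ) :=
          mul_le_mul_of_nonneg_left (Real.rpow_le_rpow_of_exponent_le hR1 hΛε) hC.le
  obtain ⟨C', hC'⟩ := polySzpiroRatEff_seven_of_abcLe hK
  exact ⟨7, C', hC'⟩

end Summit.ABC.Analytic

end
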